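import Summits.KontsevichZagierPeriods.KontsevichZagierPeriods.Theses.FermatIsogeny
import Summits.KontsevichZagierPeriods.KontsevichZagierPeriods.Theorems.FermatIsogenyBetaLinearSectorHalfIntegers

/-!
# `BetaLinearSector` — GENERIC SECTOR ASSEMBLY (level reduction over an invariant sector; base assembly from a normal-form oracle)

Crux `BetaLinearSector` (stmt-KontsevichZagierPeriods-3897, route FermatIsogeny).  Every unconditional rung of the crux landed so far
(`HalfIntegers`, `Thirds`, `Quarters`, `HalvesThirds`, `Sixths…`, `IntegerSums`, `QuartersIntSum`) repeats the same two arguments: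

* LEVEL REDUCTION: the two-sided statement `P⟦a, b, a', b'⟧` descends along the landed chains `P_lower_left` (translation = integration by
  parts inside the rules) and `P_swap_left` (`t ↦ 1 − t`), so by strong induction on `⌊a⌋ + ⌊b⌋` it reduces to exponents in `(0,1]`, for any
  SECTOR PREDICATE `S` on pairs that is invariant under `(a, b) ↦ (a, b − 1)` and `(a, b) ↦ (b, a − 1)` (`P_of_base_left_of_invariant`);
* BASE ASSEMBLY: if every base cell of a class `C` of pairs NORMALISES — is a chain of moves away from `(c q)·Tᵢ` for one of finitely many
  canonical cells `Tᵢ` with values `κ… = v i`, positive and pairwise NOT algebraic multiples of one another (the transcendence input, e.g.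
  Lindemann or Chudnovsky) — then `P⟦a, b, a', b'⟧` holds for all `C`-cells on both sides: same class ⇒ same multiple of the same cell,
  different classes ⇒ no common value, degenerate constants ⇒ two zero representations (`P_base_of_normalForm`).

This file proves the two arguments ONCE, generically (registered anchor `betaLinearSector_of_oracle`), so that the maximal unconditional sectors
are short assemblies of normal-form oracles (`betaLinearSector_of_oracle`).  Everything is elementary bookkeeping over the landed HalfIntegers API;
no transcendence here.

References: M. Kontsevich, D. Zagier, *Periods* (2001), §1.2; G. E. Andrews, R. Askey, R. Roy, *Special Functions* (1999), §1.1.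
-/

noncomputable section

namespace Summit.KontsevichZagierPeriods.FermatIsogeny.BetaLinearSector.Assembly

open MeasureTheory Set
open Literature.NumberTheory.Transcendental
open Literature.NumberTheory.Transcendental.KZ
open Summit.KontsevichZagierPeriods.FermatIsogeny.BetaLinearSector.HalfIntegers

set_option quotPrecheck false in
/-- `r` is PINNED as `[(0,1), c · t^{a-1}(1-t)^{b-1}]` (the two hypotheses on each representation in the crux, with a constant). -/
local notation "Pinned⟦" c ", " a ", " b ", " r "⟧" =>
  (IntegralRep.domain r = {x : Fin 1 → ℝ | x 0 ∈ Set.Ioo (0:ℝ) 1} ∧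
    Set.EqOn (IntegralRep.integrand r) (fun x : Fin 1 → ℝ => (c : ℝ) * (x 0) ^ (((a : ℚ) : ℝ) - 1) * (1 - x 0) ^ (((b : ℚ) : ℝ) - 1))
      (IntegralRep.domain r))

set_option quotPrecheck false in
/-- The two-sided, constant-carrying form of the crux for fixed exponents. -/
local notation "P⟦" a ", " b ", " a' ", " b' "⟧" =>
  (∀ (c c' : ℝ) (r r' : IntegralRep 1), IsAlgebraic ℚ c → IsAlgebraic ℚ c' →
    Pinned⟦c, a, b, r⟧ → Pinned⟦c', a', b', r'⟧ → IntegralRep.value r = IntegralRep.value r' → Equivalent r r')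

/-! ## Level reduction over an invariant sector predicate -/

/-- **LEVEL REDUCTION OVER AN INVARIANT SECTOR**: let `S` be a predicate on pairs of rationals with `S a b → S a (b − 1)` and
`S a b → S b (a − 1)`.  If `P⟦a₀, b₀, a', b'⟧` holds for all `S`-pairs `a₀, b₀ ∈ (0,1]`, it holds for all positive `S`-pairs (strong induction
on `⌊a⌋ + ⌊b⌋` with the landed chains `P_lower_left`, `P_swap_left`). [folklore] -/
theorem P_of_base_left_of_invariant (S : ℚ → ℚ → Prop) (hS₁ : ∀ a b, S a b → S a (b - 1)) (hS₂ : ∀ a b, S a b → S b (a - 1))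
    {a' b' : ℚ} (base : ∀ a b : ℚ, 0 < a → a ≤ 1 → 0 < b → b ≤ 1 → S a b → P⟦a, b, a', b'⟧) :
    ∀ a b : ℚ, 0 < a → 0 < b → S a b → P⟦a, b, a', b'⟧ := by
  suffices H : ∀ n : ℕ, ∀ a b : ℚ, ⌊a⌋₊ + ⌊b⌋₊ = n → 0 < a → 0 < b → S a b → P⟦a, b, a', b'⟧ from
    fun a b ha hb hm => H _ a b rfl ha hb hm
  intro n
  induction n using Nat.strong_induction_on with
  | _ n ih =>
    intro a b hn ha hb hm
    by_cases hb1 : b ≤ 1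
    · by_cases ha1 : a ≤ 1
      · exact base a b ha ha1 hb hb1 hm
      · push Not at ha1
        have ha' : 0 < a - 1 := by linarith
        have hfl : ⌊a⌋₊ = ⌊a - 1⌋₊ + 1 := by
          conv_lhs => rw [← sub_add_cancel a 1]
          exact Nat.floor_add_one ha'.le
        have hlt : ⌊b⌋₊ + ⌊a - 1⌋₊ < n := by omega
        have hP : P⟦b, (a - 1), a', b'⟧ := ih _ hlt b (a - 1) rfl hb ha' (hS₂ a b hm)
        have hP' : P⟦b, a, a', b'⟧ := by simpa using P_lower_left hb ha' hP
        exact P_swap_left ha hb hP'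
    · push Not at hb1
      have hb' : 0 < b - 1 := by linarith
      have hfl : ⌊b⌋₊ = ⌊b - 1⌋₊ + 1 := by
        conv_lhs => rw [← sub_add_cancel b 1]
        exact Nat.floor_add_one hb'.le
      have hlt : ⌊a⌋₊ + ⌊b - 1⌋₊ < n := by omega
      have hP : P⟦a, (b - 1), a', b'⟧ := ih _ hlt a (b - 1) rfl ha hb' (hS₁ a b hm)
      simpa using P_lower_left ha hb' hP

/-- **TWO-SIDED LEVEL REDUCTION**: with `S` as above on BOTH pairs, `P` on all positive `S`-pairs follows from `P` on the base `S`-pairs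
(exponents in `(0,1]`) on both sides. [folklore] -/
theorem P_of_base_of_invariant (S : ℚ → ℚ → Prop) (hS₁ : ∀ a b, S a b → S a (b - 1)) (hS₂ : ∀ a b, S a b → S b (a - 1))
    (base : ∀ a b a' b' : ℚ, 0 < a → a ≤ 1 → 0 < b → b ≤ 1 → S a b → 0 < a' → a' ≤ 1 → 0 < b' → b' ≤ 1 → S a' b' → P⟦a, b, a', b'⟧)
    {a b a' b' : ℚ} (ha : 0 < a) (hb : 0 < b) (ha' : 0 < a') (hb' : 0 < b') (hm : S a b) (hm' : S a' b') : P⟦a, b, a', b'⟧ := by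
  refine P_of_base_left_of_invariant S hS₁ hS₂ (fun a₀ b₀ ha₀ ha₀1 hb₀ hb₀1 hm₀ => ?_) a b ha hb hm
  refine P_symm (P_of_base_left_of_invariant S hS₁ hS₂ (a' := a₀) (b' := b₀) (fun a₁ b₁ ha₁ ha₁1 hb₁ hb₁1 hm₁ => ?_) a' b' ha' hb' hm')
  exact P_symm (base a₀ b₀ a₁ b₁ ha₀ ha₀1 hb₀ hb₀1 hm₀ ha₁ ha₁1 hb₁ hb₁1 hm₁)

/-! ## Base assembly from a normal-form oracle -/

/-- **BASE ASSEMBLY FROM A NORMAL-FORM ORACLE** (registered anchor).  Data: a class `C` of pairs of positive rationals; finitely many canonical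
representations `T : Fin k → IntegralRep 1` with values `(T i).value = v i`, `0 < v i`, and the SEPARATION `v i ≠ κ · v j` for `i ≠ j` and every
real algebraic `κ` (the transcendence input of the sector); and a NORMAL-FORM ORACLE: every representation pinned `(c, a, b)` with `C a b`, `c` real
algebraic, is KZ-equivalent to `(c q)·T i` for some `i` and some real `q ≠ 0` with `c q` algebraic.  Then `P⟦a, b, a', b'⟧` for all `C`-pairs on
both sides: by soundness the values are `c q v_i`, `c' q' v_{i'}`; the degenerate constant `c = 0` forces `c' = 0` and two zero representations
(rule 1b); `i = i'` forces `c q = c' q'` and the two normal forms meet (rule 1b on the constants); `i ≠ i'` contradicts the separation.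
[cite: KontsevichZagier2001, §1.2] -/
theorem P_base_of_normalForm {k : ℕ} (C : ℚ → ℚ → Prop) (hCpos : ∀ a b, C a b → 0 < a ∧ 0 < b)
    (T : Fin k → IntegralRep 1) (v : Fin k → ℝ) (hTv : ∀ i, (T i).value = v i) (hv : ∀ i, 0 < v i)
    (hsep : ∀ i j : Fin k, i ≠ j → ∀ κ : ℝ, IsAlgebraic ℚ κ → v i ≠ κ * v j)
    (NF : ∀ (c : ℝ) (hc : IsAlgebraic ℚ c) (a b : ℚ), C a b → ∀ r : IntegralRep 1, Pinned⟦c, a, b, r⟧ →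
      ∃ (i : Fin k) (q : ℝ) (hk : IsAlgebraic ℚ (c * q)), q ≠ 0 ∧ Equivalent r ((T i).constMul (c * q) hk))
    {a b a' b' : ℚ} (hab : C a b) (hab' : C a' b') : P⟦a, b, a', b'⟧ := by
  obtain ⟨ha, hb⟩ := hCpos a b hab
  obtain ⟨ha', hb'⟩ := hCpos a' b' hab'
  intro c c' r r' hc hc' hr hr' hval
  have hvr := value_of_pinned hr ha hb
  have hvr' := value_of_pinned hr' ha' hb'
  have hBpos : ∀ {p q : ℚ}, 0 < p → 0 < q →
      0 < Real.Gamma (p:ℝ) * Real.Gamma (q:ℝ) / Real.Gamma ((p:ℝ) + (q:ℝ)) := fun {p q} hp hq => by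
    have hpR : (0:ℝ) < p := by exact_mod_cast hp
    have hqR : (0:ℝ) < q := by exact_mod_cast hq
    exact div_pos (mul_pos (Real.Gamma_pos_of_pos hpR) (Real.Gamma_pos_of_pos hqR)) (Real.Gamma_pos_of_pos (by linarith))
  -- the degenerate constants
  by_cases hc0 : c = 0
  · have hc'0 : c' = 0 := by
      have h0 : c' * (Real.Gamma (a':ℝ) * Real.Gamma (b':ℝ) / Real.Gamma ((a':ℝ) + (b':ℝ))) = 0 := by
        rw [← hvr', ← hval, hvr, hc0, zero_mul]
      exact (mul_eq_zero.1 h0).resolve_right (hBpos ha' hb').ne'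
    have h1 : of r ∈ relations := of_mem_relations_of_eqOn_zero r fun x hx => by
      rw [hr.2 hx]
      simp [hc0]
    have h2 : of r' ∈ relations := of_mem_relations_of_eqOn_zero r' fun x hx => by
      rw [hr'.2 hx]
      simp [hc'0]
    exact relations.sub_mem h1 h2
  have hc'0 : c' ≠ 0 := by
    intro h
    have h0 : c * (Real.Gamma (a:ℝ) * Real.Gamma (b:ℝ) / Real.Gamma ((a:ℝ) + (b:ℝ))) = 0 := by
      rw [← hvr, hval, hvr', h, zero_mul]
    exact hc0 ((mul_eq_zero.1 h0).resolve_right (hBpos ha hb).ne')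
  -- normal forms and values
  obtain ⟨i, q, hk, hq, e⟩ := NF c hc a b hab r hr
  obtain ⟨i', q', hk', hq', e'⟩ := NF c' hc' a' b' hab' r' hr'
  have hvalr : r.value = c * q * v i := by rw [Equivalent.value_eq_holds e, IntegralRep.value_constMul, hTv]
  have hvalr' : r'.value = c' * q' * v i' := by rw [Equivalent.value_eq_holds e', IntegralRep.value_constMul, hTv]
  have h := hval
  rw [hvalr, hvalr'] at h
  by_cases hii : i = i'
  · -- same class: the same multiple of the same canonical cell
    subst hii
    have hcq : c * q = c' * q' := mul_right_cancel₀ (hv i).ne' h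
    have emid : Equivalent ((T i).constMul (c * q) hk) ((T i).constMul (c' * q') hk') :=
      of_sub_of_mem_relations_of_eqOn rfl fun x _ => by simp only [IntegralRep.integrand_constMul, hcq]
    exact e.trans (emid.trans e'.symm)
  · -- different classes: the separation
    exfalso
    have hcq0 : c * q ≠ 0 := mul_ne_zero hc0 hq
    refine hsep i i' hii (c' * q' * (c * q)⁻¹) (hk'.mul hk.inv) ?_
    rw [← inv_mul_cancel_left₀ hcq0 (v i), h]
    ring

/-- **SECTOR THEOREM FROM AN ORACLE** (registered anchor `betaLinearSector_of_oracle`, stated without the local notation): combine the two-sided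
level reduction over an invariant sector `S` with the base assembly for the class `C` of base cells, given that every base `S`-pair (exponents in
`(0,1]`) is a `C`-pair.  The conclusion is the crux `BetaLinearSector` restricted to `S`-pairs on both sides, in the two-sided constant-carrying
form. [cite: KontsevichZagier2001, §1.2] -/
theorem betaLinearSector_of_oracle : ∀ {k : ℕ} (S : ℚ → ℚ → Prop), (∀ a b, S a b → S a (b - 1)) → (∀ a b, S a b → S b (a - 1)) →
    ∀ (C : ℚ → ℚ → Prop), (∀ a b, 0 < a → a ≤ 1 → 0 < b → b ≤ 1 → S a b → C a b) → (∀ a b, C a b → 0 < a ∧ 0 < b) →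
    ∀ (T : Fin k → KZ.IntegralRep 1) (v : Fin k → ℝ), (∀ i, (T i).value = v i) → (∀ i, 0 < v i) →
    (∀ i j : Fin k, i ≠ j → ∀ κ : ℝ, IsAlgebraic ℚ κ → v i ≠ κ * v j) →
    (∀ (c : ℝ), IsAlgebraic ℚ c → ∀ (a b : ℚ), C a b → ∀ r : KZ.IntegralRep 1,
      (r.domain = {x | x 0 ∈ Set.Ioo (0:ℝ) 1} ∧ Set.EqOn r.integrand (fun x => c * (x 0) ^ ((a:ℝ) - 1) * (1 - x 0) ^ ((b:ℝ) - 1)) r.domain) →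
      ∃ (i : Fin k) (q : ℝ) (hk : IsAlgebraic ℚ (c * q)), q ≠ 0 ∧ KZ.Equivalent r ((T i).constMul (c * q) hk)) →
    ∀ (a b a' b' : ℚ), 0 < a → 0 < b → 0 < a' → 0 < b' → S a b → S a' b' →
    ∀ (c c' : ℝ) (r r' : KZ.IntegralRep 1), IsAlgebraic ℚ c → IsAlgebraic ℚ c' →
    (r.domain = {x | x 0 ∈ Set.Ioo (0:ℝ) 1} ∧ Set.EqOn r.integrand (fun x => c * (x 0) ^ ((a:ℝ) - 1) * (1 - x 0) ^ ((b:ℝ) - 1)) r.domain) →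
    (r'.domain = {x | x 0 ∈ Set.Ioo (0:ℝ) 1} ∧ Set.EqOn r'.integrand (fun x => c' * (x 0) ^ ((a':ℝ) - 1) * (1 - x 0) ^ ((b':ℝ) - 1)) r'.domain) →
    r.value = r'.value → KZ.Equivalent r r' := by
  intro k S hS₁ hS₂ C hSC hCpos T v hTv hv hsep NF a b a' b' ha hb ha' hb' hm hm'
  exact P_of_base_of_invariant S hS₁ hS₂
    (fun a₀ b₀ a₁ b₁ ha₀ ha₀1 hb₀ hb₀1 hm₀ ha₁ ha₁1 hb₁ hb₁1 hm₁ =>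
      P_base_of_normalForm C hCpos T v hTv hv hsep (fun c hc a b hab r hr => NF c hc a b hab r hr)
        (hSC a₀ b₀ ha₀ ha₀1 hb₀ hb₀1 hm₀) (hSC a₁ b₁ ha₁ ha₁1 hb₁ hb₁1 hm₁))
    ha hb ha' hb' hm hm'

end Summit.KontsevichZagierPeriods.FermatIsogeny.BetaLinearSector.Assembly

end
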